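import Literature.Analysis.FluidPDE.FractionalNSPrescribedEnergy
import Literature.Analysis.FunctionSpaces.TorusAxisAverage
import Literature.Analysis.FunctionSpaces.TorusFourierCalculus
import HarnessLib

/-!
# De Rosa 2019, Cor. 7.2 — discharge: fractional dissipation of Hölder fields

Analysis/FluidPDE proof file, definition-free; sibling of `FractionalNSPrescribedEnergy.lean`.
It proves the named fact `Literature.Analysis.FluidPDE.DeRosa2019_cor72`
(`theorem DeRosa2019_cor72_holds`): for `0 < γ < 1`, `0 < ε`, `γ + ε ≤ 1` there is
`C = C(γ, ε)` with `∫_{𝕋³} |(-Δ)^{γ/2} f|² ≤ C [f]²_{γ+ε}` for every `f ∈ C^{γ+ε}(𝕋³; ℝ³)`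
(De Rosa, Comm. PDE 44 (2019), §7 Cor. 7.2, p. 19 of arXiv:1801.10235; there a corollary of
Thm. 7.1 = Roncal–Stinga 2016 Thm. 1.4, stated without proof).

In the tree the left-hand side is spectral,
`Torus.eFracDissipation γ f = (4π²)^γ ∑_{k ≠ 0} (|k|²)^γ ‖f̂(k)‖²` (`FractionalNSTorus`), so the
statement is the classical embedding `C^{α}(𝕋^d) ⊂ Ḣ^γ(𝕋^d)` for `γ < α` (Bernstein/Zygmund),
which we prove directly on the Fourier side, in every dimension `d` and for `ℂ^ι`-valued
fields (`Torus.exists_eHomSobolevSeminorm_sq_le_of_holderWith`):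

* **translates** (`Torus.mFourierCoeff_translate_sub`, from `Torus.mFourierCoeff_comp_add_single`
  of `TorusAxisAverage`): for the axis translate `D = g(· + s eᵢ) - g`,
  `D̂(k) = (e_{kᵢ}(s) - 1) ĝ(k)`; by Parseval (`Torus.tsum_enorm_sq_mFourierCoeff_euclidean`)
  and the Hölder bound `‖D‖_∞ ≤ C |s|^α` (`dist (x + s eᵢ) x = ‖s‖_{ℝ/ℤ} = |s|` for
  `|s| ≤ 1/2`), `∑_k |e_{kᵢ}(s) - 1|² ‖ĝ(k)‖² ≤ (C |s|^α)²`
  (`Torus.tsum_sq_fourier_sub_one_mul_le`);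
* **dyadic blocks** (`Torus.exists_dyadic_coord`, `Torus.one_le_norm_fourier_sub_one`): every
  `k ≠ 0` has a coordinate `i` and a `j ∈ ℕ` with `2^j ≤ |kᵢ| < 2^{j+1}` and
  `|k|² ≤ (#d) 4^{j+1}`; for `s_j = 2^{-(j+2)}` the angle `2π kᵢ s_j` lies in `±[π/2, π]`,
  where `cos ≤ 0`, so `|e_{kᵢ}(s_j) - 1| ≥ 1 - cos ≥ 1`; hence the weight `(|k|²)^γ` is bounded
  by `∑ᵢ ∑ⱼ ((#d) 4^{j+2})^γ |e_{kᵢ}(s_j) - 1|²` (`Torus.homSobolevWeight_le_sum_tsum`);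
* **summation**: exchanging the sums (`ℝ≥0∞`-valued, unconditional) gives
  `|g|²_{Ḣ^γ} ≤ (#d) ∑ⱼ ((#d) 4^{j+2})^γ 4^{-(j+2)α} · C² = S C²` with `S < ∞` a geometric series of
  ratio `4^{γ-α} < 1` (`Torus.dyadic_tsum_lt_top`).

The constant produced for Cor. 7.2 is `(4π²)^γ S + 1`, depending on `γ` and `ε` only.

## References

* L. De Rosa, *Infinitely many Leray–Hopf solutions for the fractional Navier–Stokes equations*,
  Comm. PDE 44 (2019), 335–365 = arXiv:1801.10235, §7, Thm. 7.1 and Cor. 7.2 (p. 19).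
  [`Derosa2018`]
* L. Roncal, P. R. Stinga, *Fractional Laplacian on the torus*, Commun. Contemp. Math. 18
  (2016), Thm. 1.4. [`RoncalStinga2016`]
* L. Grafakos, *Classical Fourier Analysis*, 3rd ed. (2014), Prop. 3.1.2 (5) (translates),
  Prop. 3.2.7 (3) (Parseval), §3.3 (decay of Fourier coefficients of Hölder functions).
  [`Grafakos2014`]
-/

noncomputable section

open MeasureTheory Set Filter Topology UnitAddTorus
open scoped ENNReal NNReal

namespace Literature.Analysis.FluidPDE

namespace Torus

variable {d : Type*} [Fintype d]

/-! ## Elementary real identities for the dyadic constants -/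

omit [Fintype d] in
/-- `(c y²)^γ ((y⁻¹)^a)² = c^γ y^{2γ-2a}` for `c ≥ 0`, `y > 0`. [folklore] -/
theorem dyadic_term_eq {γ a c y : ℝ} (hc : 0 ≤ c) (hy : 0 < y) :
    (c * y ^ 2) ^ γ * ((y⁻¹) ^ a) ^ 2 = c ^ γ * y ^ (2 * γ - 2 * a) := by
  rw [Real.mul_rpow hc (by positivity), Real.inv_rpow hy.le, ← Real.rpow_neg hy.le,
    ← Real.rpow_natCast_mul hy.le, ← Real.rpow_mul_natCast hy.le, mul_assoc, ← Real.rpow_add hy]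
  congr 2
  push_cast
  ring

omit [Fintype d] in
/-- The dyadic series `∑ⱼ (c 4^{j+2})^γ 4^{-(j+2)a}` is finite for `γ < a` (geometric series of
ratio `4^{γ-a} < 1`). [folklore] -/
theorem dyadic_tsum_lt_top {γ a c : ℝ} (hc : 0 ≤ c) (hγa : γ < a) :
    ∑' j : ℕ, ENNReal.ofReal ((c * ((2 : ℝ) ^ (j + 2)) ^ 2) ^ γ) *
        ENNReal.ofReal ((((2 : ℝ) ^ (j + 2))⁻¹) ^ a) ^ 2 < ⊤ := by
  set ρ : ℝ := (2 : ℝ) ^ (2 * γ - 2 * a) with hρ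
  have hρ0 : 0 ≤ ρ := Real.rpow_nonneg (by norm_num) _
  have hρ1 : ρ < 1 := Real.rpow_lt_one_of_one_lt_of_neg (by norm_num) (by linarith)
  have hterm : ∀ j : ℕ, ENNReal.ofReal ((c * ((2 : ℝ) ^ (j + 2)) ^ 2) ^ γ) *
      ENNReal.ofReal ((((2 : ℝ) ^ (j + 2))⁻¹) ^ a) ^ 2 = ENNReal.ofReal (c ^ γ * ρ ^ 2 * ρ ^ j) := by
    intro j
    have hy : (0 : ℝ) < (2 : ℝ) ^ (j + 2) := by positivity
    rw [← ENNReal.ofReal_pow (Real.rpow_nonneg (inv_nonneg.2 hy.le) _),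
      ← ENNReal.ofReal_mul (Real.rpow_nonneg (by positivity) _), dyadic_term_eq hc hy,
      ← Real.rpow_natCast_mul (by norm_num : (0 : ℝ) ≤ 2), mul_comm ((j + 2 : ℕ) : ℝ),
      Real.rpow_mul_natCast (by norm_num : (0 : ℝ) ≤ 2), ← hρ, pow_add]
    ring_nf
  rw [tsum_congr hterm, ← ENNReal.ofReal_tsum_of_nonneg (fun j => by positivity)
    (((summable_geometric_of_lt_one hρ0 hρ1).mul_left (c ^ γ * ρ ^ 2)))]
  exact ENNReal.ofReal_lt_top

/-! ## Characters a quarter to a half turn away from `1` -/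

omit [Fintype d] in
/-- If `2^j ≤ |n| ≤ 2^{j+1}` then the character `e_n` of `ℝ/ℤ` at the point `s = 2^{-(j+2)}` is at
distance at least `1` from `1`: its angle `2π n s` lies in `±[π/2, π]`, where `cos ≤ 0`, so
`‖e_n(s) - 1‖ ≥ 1 - cos(2π n s) ≥ 1`. [folklore] -/
theorem one_le_norm_fourier_sub_one {n : ℤ} {j : ℕ} (h₁ : (2 : ℝ) ^ j ≤ |(n : ℝ)|)
    (h₂ : |(n : ℝ)| ≤ (2 : ℝ) ^ (j + 1)) :
    1 ≤ ‖fourier n ((((2 : ℝ) ^ (j + 2))⁻¹ : ℝ) : UnitAddCircle) - 1‖ := by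
  set θ : ℝ := 2 * Real.pi * n * ((2 : ℝ) ^ (j + 2))⁻¹ with hθ
  have hfour : fourier n ((((2 : ℝ) ^ (j + 2))⁻¹ : ℝ) : UnitAddCircle) =
      Complex.exp (θ * Complex.I) := by
    rw [fourier_coe_apply]
    congr 1
    rw [hθ]
    push_cast
    ring
  have h2pos : (0 : ℝ) < (2 : ℝ) ^ (j + 2) := by positivity
  have habs : |θ| = 2 * Real.pi * |(n : ℝ)| * ((2 : ℝ) ^ (j + 2))⁻¹ := by
    rw [hθ, abs_mul, abs_mul, abs_inv, abs_of_pos h2pos,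
      abs_of_pos (by positivity : (0 : ℝ) < 2 * Real.pi)]
  have hlow : Real.pi / 2 ≤ |θ| := by
    rw [habs]
    calc Real.pi / 2 = 2 * Real.pi * (2 : ℝ) ^ j * ((2 : ℝ) ^ (j + 2))⁻¹ := by
          rw [pow_add]; field_simp
      _ ≤ 2 * Real.pi * |(n : ℝ)| * ((2 : ℝ) ^ (j + 2))⁻¹ := by gcongr
  have hup : |θ| ≤ Real.pi := by
    rw [habs]
    calc 2 * Real.pi * |(n : ℝ)| * ((2 : ℝ) ^ (j + 2))⁻¹
        ≤ 2 * Real.pi * (2 : ℝ) ^ (j + 1) * ((2 : ℝ) ^ (j + 2))⁻¹ := by gcongr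
      _ = Real.pi := by rw [pow_add, pow_add]; field_simp
  have hcos : Real.cos θ ≤ 0 := by
    rw [← Real.cos_abs]
    exact Real.cos_nonpos_of_pi_div_two_le_of_le hlow (by linarith [Real.pi_pos])
  rw [hfour]
  calc (1 : ℝ) ≤ |(Complex.exp (θ * Complex.I) - 1).re| := by
        rw [Complex.sub_re, Complex.exp_ofReal_mul_I_re, Complex.one_re,
          abs_of_nonpos (by linarith [Real.cos_le_one θ])]
        linarith
    _ ≤ ‖Complex.exp (θ * Complex.I) - 1‖ := Complex.abs_re_le_norm _

omit [Fintype d] in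
/-- For `|s| ≤ 1/2` the point `s` of `ℝ/ℤ` has norm `|s|`. [folklore] -/
theorem norm_coe_unitAddCircle_eq_abs {s : ℝ} (hs : |s| ≤ 1 / 2) :
    ‖((s : ℝ) : UnitAddCircle)‖ = |s| :=
  (AddCircle.norm_coe_eq_abs_iff (p := (1 : ℝ)) one_ne_zero).2 (by simpa using hs)

/-! ## Dyadic decomposition of the frequencies -/

/-- Every nonzero frequency `k ∈ ℤ^d` has a coordinate `i` (one of maximal modulus) and a dyadic
scale `j` with `2^j ≤ |kᵢ| < 2^{j+1}` and `|k|² ≤ (#d) (2^{j+1})²`. [folklore] -/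
theorem exists_dyadic_coord {k : d → ℤ} (hk : k ≠ 0) :
    ∃ i : d, ∃ j : ℕ, (2 : ℝ) ^ j ≤ |(k i : ℝ)| ∧ |(k i : ℝ)| < (2 : ℝ) ^ (j + 1) ∧
      FunctionSpaces.Torus.freqNormSq k ≤ Fintype.card d * ((2 : ℝ) ^ (j + 1)) ^ 2 := by
  obtain ⟨i₀, hi₀⟩ : ∃ i, k i ≠ 0 := Function.ne_iff.1 hk
  obtain ⟨i, -, hi⟩ :=
    Finset.exists_max_image Finset.univ (fun i => |k i|) ⟨i₀, Finset.mem_univ _⟩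
  have hki : k i ≠ 0 := by
    intro h0
    have h := hi i₀ (Finset.mem_univ _)
    rw [h0, abs_zero] at h
    exact hi₀ (abs_nonpos_iff.1 h)
  set m : ℕ := (k i).natAbs with hm
  have hm0 : m ≠ 0 := Int.natAbs_ne_zero.2 hki
  have hmR : (m : ℝ) = |(k i : ℝ)| := by
    rw [hm, Nat.cast_natAbs, Int.cast_abs]
  have hlt : |(k i : ℝ)| < (2 : ℝ) ^ (Nat.log 2 m + 1) := by
    rw [← hmR]
    exact_mod_cast Nat.lt_pow_succ_log_self one_lt_two m
  refine ⟨i, Nat.log 2 m, ?_, hlt, ?_⟩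
  · rw [← hmR]
    exact_mod_cast Nat.pow_log_le_self 2 hm0
  · have hle : ∀ i', ((k i' : ℤ) : ℝ) ^ 2 ≤ ((2 : ℝ) ^ (Nat.log 2 m + 1)) ^ 2 := by
      intro i'
      have h1 : |(k i' : ℝ)| ≤ |(k i : ℝ)| := by exact_mod_cast hi i' (Finset.mem_univ _)
      rw [← sq_abs]
      exact pow_le_pow_left₀ (abs_nonneg _) (h1.trans hlt.le) 2
    calc FunctionSpaces.Torus.freqNormSq k = ∑ i', ((k i' : ℤ) : ℝ) ^ 2 := rfl
      _ ≤ ∑ _i' : d, ((2 : ℝ) ^ (Nat.log 2 m + 1)) ^ 2 := Finset.sum_le_sum fun i' _ => hle i'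
      _ = Fintype.card d * ((2 : ℝ) ^ (Nat.log 2 m + 1)) ^ 2 := by
          rw [Finset.sum_const, Finset.card_univ, nsmul_eq_mul]

/-- **Pointwise bound on the `Ḣ^γ` weight by dyadic character differences**: for `γ ≥ 0` and
every `k ∈ ℤ^d`, `𝟙_{k ≠ 0} (|k|²)^γ ≤ ∑ᵢ ∑ⱼ ((#d) 4^{j+2})^γ |e_{kᵢ}(2^{-(j+2)}) - 1|²` (only the
term at the dyadic block of a maximal coordinate of `k` is used). [folklore] -/
theorem homSobolevWeight_le_sum_tsum {γ : ℝ} (hγ : 0 ≤ γ) (k : d → ℤ) :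
    (if k = 0 then 0 else ENNReal.ofReal (FunctionSpaces.Torus.freqNormSq k ^ γ)) ≤
      ∑ i : d, ∑' j : ℕ, ENNReal.ofReal ((Fintype.card d * ((2 : ℝ) ^ (j + 2)) ^ 2) ^ γ) *
        ‖fourier (k i) ((((2 : ℝ) ^ (j + 2))⁻¹ : ℝ) : UnitAddCircle) - 1‖ₑ ^ 2 := by
  split_ifs with hk
  · exact bot_le
  obtain ⟨i, j, h1, h2, h3⟩ := exists_dyadic_coord hk
  have hone : (1 : ℝ≥0∞) ≤ ‖fourier (k i) ((((2 : ℝ) ^ (j + 2))⁻¹ : ℝ) : UnitAddCircle) - 1‖ₑ ^ 2 := by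
    have h' : (1 : ℝ≥0∞) ≤ ‖fourier (k i) ((((2 : ℝ) ^ (j + 2))⁻¹ : ℝ) : UnitAddCircle) - 1‖ₑ := by
      rw [← ofReal_norm, ← ENNReal.ofReal_one]
      exact ENNReal.ofReal_le_ofReal (one_le_norm_fourier_sub_one h1 h2.le)
    calc (1 : ℝ≥0∞) = 1 * 1 := (one_mul 1).symm
      _ ≤ _ := by rw [sq]; exact mul_le_mul' h' h'
  calc ENNReal.ofReal (FunctionSpaces.Torus.freqNormSq k ^ γ)
      ≤ ENNReal.ofReal ((Fintype.card d * ((2 : ℝ) ^ (j + 2)) ^ 2) ^ γ) := by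
        refine ENNReal.ofReal_le_ofReal
          (Real.rpow_le_rpow (FunctionSpaces.Torus.freqNormSq_nonneg k) (h3.trans ?_) hγ)
        exact mul_le_mul_of_nonneg_left
          (pow_le_pow_left₀ (by positivity) (pow_le_pow_right₀ one_le_two (by omega)) 2)
          (Nat.cast_nonneg _)
    _ ≤ ENNReal.ofReal ((Fintype.card d * ((2 : ℝ) ^ (j + 2)) ^ 2) ^ γ) *
          ‖fourier (k i) ((((2 : ℝ) ^ (j + 2))⁻¹ : ℝ) : UnitAddCircle) - 1‖ₑ ^ 2 :=
        le_mul_of_one_le_right' hone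
    _ ≤ ∑' j' : ℕ, ENNReal.ofReal ((Fintype.card d * ((2 : ℝ) ^ (j' + 2)) ^ 2) ^ γ) *
          ‖fourier (k i) ((((2 : ℝ) ^ (j' + 2))⁻¹ : ℝ) : UnitAddCircle) - 1‖ₑ ^ 2 :=
        ENNReal.le_tsum j
    _ ≤ ∑ i' : d, ∑' j' : ℕ, ENNReal.ofReal ((Fintype.card d * ((2 : ℝ) ^ (j' + 2)) ^ 2) ^ γ) *
          ‖fourier (k i') ((((2 : ℝ) ^ (j' + 2))⁻¹ : ℝ) : UnitAddCircle) - 1‖ₑ ^ 2 :=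
        Finset.single_le_sum (f := fun i' : d => ∑' j' : ℕ,
            ENNReal.ofReal ((Fintype.card d * ((2 : ℝ) ^ (j' + 2)) ^ 2) ^ γ) *
              ‖fourier (k i') ((((2 : ℝ) ^ (j' + 2))⁻¹ : ℝ) : UnitAddCircle) - 1‖ₑ ^ 2)
          (fun _ _ => bot_le) (Finset.mem_univ i)

/-! ## Axis translates: Fourier coefficients and the Hölder bound -/

variable [DecidableEq d]

/-- Fourier coefficients of the increment under an axis translation:
`𝓕(g(· + u eᵢ) - g)(k) = (e_{kᵢ}(u) - 1) 𝓕g(k)` for continuous `g`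
(Grafakos 2014, Prop. 3.1.2 (5)). [cite: Grafakos2014, Prop. 3.1.2 (5)] -/
theorem mFourierCoeff_translate_sub {E : Type*} [NormedAddCommGroup E] [NormedSpace ℂ E]
    {g : UnitAddTorus d → E} (hg : Continuous g) (k : d → ℤ) (i : d) (u : UnitAddCircle) :
    mFourierCoeff (fun x => g (x + Pi.single i u) - g x) k =
      (fourier (k i) u - 1) • mFourierCoeff g k := by
  have hτ : Continuous (fun x => g (x + Pi.single i u)) := hg.comp (continuous_id.add continuous_const)
  have h1 : (fun x => g (x + Pi.single i u) - g x) = (fun x => g (x + Pi.single i u)) - g := rfl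
  rw [h1, FunctionSpaces.Torus.mFourierCoeff_sub hτ.integrable_unitAddTorus hg.integrable_unitAddTorus,
    FunctionSpaces.Torus.mFourierCoeff_comp_add_single, sub_smul, one_smul]

/-- **Translation estimate**: for an `α`-Hölder field `g : 𝕋^d → ℂ^ι` with constant `C`, an axis
`i` and `|s| ≤ 1/2`, `∑_k |e_{kᵢ}(s) - 1|² ‖ĝ(k)‖² = ‖g(· + s eᵢ) - g‖²_{L²} ≤ (C |s|^α)²`
(Parseval for the increment, whose sup norm is at most `C · dist(x + s eᵢ, x)^α = C |s|^α`).
[folklore] -/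
theorem tsum_sq_fourier_sub_one_mul_le {ι : Type*} [Fintype ι] {α C : ℝ≥0}
    {g : UnitAddTorus d → EuclideanSpace ℂ ι} (hg : HolderWith C α g) (hα : 0 < α) (i : d)
    {s : ℝ} (hs : |s| ≤ 1 / 2) :
    ∑' k : d → ℤ, ‖fourier (k i) (s : UnitAddCircle) - 1‖ₑ ^ 2 * ‖mFourierCoeff g k‖ₑ ^ 2 ≤
      ((C : ℝ≥0∞) * ENNReal.ofReal (|s| ^ (α : ℝ))) ^ 2 := by
  have hgc : Continuous g := hg.continuous hα
  have hτ : Continuous (fun x => g (x + Pi.single i (s : UnitAddCircle))) :=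
    hgc.comp (continuous_id.add continuous_const)
  have hDc : Continuous (fun x => g (x + Pi.single i (s : UnitAddCircle)) - g x) := hτ.sub hgc
  have hlhs : ∀ k : d → ℤ, ‖fourier (k i) (s : UnitAddCircle) - 1‖ₑ ^ 2 * ‖mFourierCoeff g k‖ₑ ^ 2 =
      ‖mFourierCoeff (fun x => g (x + Pi.single i (s : UnitAddCircle)) - g x) k‖ₑ ^ 2 := by
    intro k
    rw [mFourierCoeff_translate_sub hgc, enorm_smul, mul_pow]
  rw [tsum_congr hlhs, FunctionSpaces.Torus.tsum_enorm_sq_mFourierCoeff_euclidean hDc]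
  have hdist : ∀ x : UnitAddTorus d, dist (x + Pi.single i (s : UnitAddCircle)) x ≤ |s| := by
    intro x
    rw [dist_self_add_left, Pi.norm_single, norm_coe_unitAddCircle_eq_abs hs]
  have hpt : ∀ x : UnitAddTorus d,
      ‖g (x + Pi.single i (s : UnitAddCircle)) - g x‖ ^ 2 ≤ ((C : ℝ) * |s| ^ (α : ℝ)) ^ 2 := by
    intro x
    have h1 : ‖g (x + Pi.single i (s : UnitAddCircle)) - g x‖ ≤ C * |s| ^ (α : ℝ) := by
      rw [← dist_eq_norm]
      exact hg.dist_le_of_le (hdist x)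
    exact pow_le_pow_left₀ (norm_nonneg _) h1 2
  have hi : Integrable (fun x => ‖g (x + Pi.single i (s : UnitAddCircle)) - g x‖ ^ 2) volume :=
    (hDc.norm.pow 2).integrable_unitAddTorus
  have hint : ∫ x, ‖g (x + Pi.single i (s : UnitAddCircle)) - g x‖ ^ 2 ≤
      ((C : ℝ) * |s| ^ (α : ℝ)) ^ 2 := by
    have h := integral_mono (μ := volume) hi (integrable_const (((C : ℝ) * |s| ^ (α : ℝ)) ^ 2))
      fun x => hpt x
    simpa using h
  refine (ENNReal.ofReal_le_ofReal hint).trans_eq ?_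
  rw [ENNReal.ofReal_pow (by positivity), ENNReal.ofReal_mul (by positivity),
    ENNReal.ofReal_coe_nnreal]

omit [DecidableEq d] in
/-- Rearrangement of the triple sum (all terms in `ℝ≥0∞`, unconditional). [folklore] -/
theorem tsum_sum_tsum_mul_rearrange {κ : Type*} (A : ℕ → ℝ≥0∞) (B : d → ℕ → κ → ℝ≥0∞)
    (G : κ → ℝ≥0∞) :
    ∑' k, (∑ i : d, ∑' j, A j * B i j k) * G k = ∑ i : d, ∑' j, A j * ∑' k, B i j k * G k := by
  calc ∑' k, (∑ i : d, ∑' j, A j * B i j k) * G k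
      = ∑' k, ∑ i : d, ∑' j, A j * (B i j k * G k) := by
        refine tsum_congr fun k => ?_
        rw [Finset.sum_mul]
        refine Finset.sum_congr rfl fun i _ => ?_
        rw [← ENNReal.tsum_mul_right]
        refine tsum_congr fun j => ?_
        rw [mul_assoc]
    _ = ∑ i : d, ∑' k, ∑' j, A j * (B i j k * G k) :=
        Summable.tsum_finsetSum fun i _ => ENNReal.summable
    _ = ∑ i : d, ∑' j, ∑' k, A j * (B i j k * G k) :=
        Finset.sum_congr rfl fun i _ => ENNReal.tsum_comm
    _ = ∑ i : d, ∑' j, A j * ∑' k, B i j k * G k := by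
        refine Finset.sum_congr rfl fun i _ => tsum_congr fun j => ?_
        rw [ENNReal.tsum_mul_left]

/-- **Hölder fields have finite homogeneous Sobolev seminorms of every smaller order**
(`C^α(𝕋^d) ⊂ Ḣ^γ(𝕋^d)` for `0 ≤ γ < α`, with a constant depending on `d, γ, α` only):
there is `S = S(d, γ, α) < ∞` with `|g|²_{Ḣ^γ} ≤ S C²` for every `ℂ^ι`-valued field `g` which
is `α`-Hölder with constant `C` (Grafakos 2014, §3.3; the Fourier-side proof through axis
translates and dyadic blocks, see the file header). [folklore] -/
theorem exists_eHomSobolevSeminorm_sq_le_of_holderWith {ι : Type*} [Fintype ι] {γ : ℝ} {α : ℝ≥0}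
    (hγ : 0 ≤ γ) (hγα : γ < α) :
    ∃ S : ℝ≥0∞, S < ⊤ ∧ ∀ (C : ℝ≥0) (g : UnitAddTorus d → EuclideanSpace ℂ ι), HolderWith C α g →
      FunctionSpaces.Torus.eHomSobolevSeminorm γ g ^ 2 ≤ S * (C : ℝ≥0∞) ^ 2 := by
  have hα : (0 : ℝ≥0) < α := by
    have h : (0 : ℝ) < α := hγ.trans_lt hγα
    exact_mod_cast h
  refine ⟨Fintype.card d * ∑' j : ℕ, ENNReal.ofReal ((Fintype.card d * ((2 : ℝ) ^ (j + 2)) ^ 2) ^ γ) *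
      ENNReal.ofReal ((((2 : ℝ) ^ (j + 2))⁻¹) ^ (α : ℝ)) ^ 2, ?_, ?_⟩
  · exact ENNReal.mul_lt_top (by simp) (dyadic_tsum_lt_top (Nat.cast_nonneg _) hγα)
  intro C g hg
  rw [FunctionSpaces.Torus.eHomSobolevSeminorm, ENNReal.rpow_half_sq]
  -- the per-block estimate
  have hij : ∀ (i : d) (j : ℕ),
      ENNReal.ofReal ((Fintype.card d * ((2 : ℝ) ^ (j + 2)) ^ 2) ^ γ) *
          ∑' k : d → ℤ, ‖fourier (k i) ((((2 : ℝ) ^ (j + 2))⁻¹ : ℝ) : UnitAddCircle) - 1‖ₑ ^ 2 *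
            ‖mFourierCoeff g k‖ₑ ^ 2 ≤
        (ENNReal.ofReal ((Fintype.card d * ((2 : ℝ) ^ (j + 2)) ^ 2) ^ γ) *
          ENNReal.ofReal ((((2 : ℝ) ^ (j + 2))⁻¹) ^ (α : ℝ)) ^ 2) * (C : ℝ≥0∞) ^ 2 := by
    intro i j
    have hpos : (0 : ℝ) < ((2 : ℝ) ^ (j + 2))⁻¹ := by positivity
    have hs : |((2 : ℝ) ^ (j + 2))⁻¹| ≤ 1 / 2 := by
      rw [abs_of_pos hpos]
      calc ((2 : ℝ) ^ (j + 2))⁻¹ ≤ (2 : ℝ)⁻¹ := inv_anti₀ two_pos (le_self_pow₀ one_le_two (by omega))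
        _ = 1 / 2 := by norm_num
    calc _ ≤ ENNReal.ofReal ((Fintype.card d * ((2 : ℝ) ^ (j + 2)) ^ 2) ^ γ) *
          ((C : ℝ≥0∞) * ENNReal.ofReal (|((2 : ℝ) ^ (j + 2))⁻¹| ^ (α : ℝ))) ^ 2 :=
          mul_le_mul' le_rfl (tsum_sq_fourier_sub_one_mul_le hg hα i hs)
      _ = _ := by rw [abs_of_pos hpos]; ring
  calc _ ≤ ∑' k : d → ℤ, (∑ i : d, ∑' j : ℕ, ENNReal.ofReal ((Fintype.card d * ((2 : ℝ) ^ (j + 2)) ^ 2) ^ γ) *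
          ‖fourier (k i) ((((2 : ℝ) ^ (j + 2))⁻¹ : ℝ) : UnitAddCircle) - 1‖ₑ ^ 2) *
            ‖mFourierCoeff g k‖ₑ ^ 2 :=
        ENNReal.tsum_le_tsum fun k => mul_le_mul' (homSobolevWeight_le_sum_tsum hγ k) le_rfl
    _ = ∑ i : d, ∑' j : ℕ, ENNReal.ofReal ((Fintype.card d * ((2 : ℝ) ^ (j + 2)) ^ 2) ^ γ) *
          ∑' k : d → ℤ, ‖fourier (k i) ((((2 : ℝ) ^ (j + 2))⁻¹ : ℝ) : UnitAddCircle) - 1‖ₑ ^ 2 *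
            ‖mFourierCoeff g k‖ₑ ^ 2 :=
        tsum_sum_tsum_mul_rearrange
          (fun j => ENNReal.ofReal ((Fintype.card d * ((2 : ℝ) ^ (j + 2)) ^ 2) ^ γ))
          (fun i j k => ‖fourier (k i) ((((2 : ℝ) ^ (j + 2))⁻¹ : ℝ) : UnitAddCircle) - 1‖ₑ ^ 2)
          (fun k => ‖mFourierCoeff g k‖ₑ ^ 2)
    _ ≤ ∑ _i : d, ∑' j : ℕ, (ENNReal.ofReal ((Fintype.card d * ((2 : ℝ) ^ (j + 2)) ^ 2) ^ γ) *
          ENNReal.ofReal ((((2 : ℝ) ^ (j + 2))⁻¹) ^ (α : ℝ)) ^ 2) * (C : ℝ≥0∞) ^ 2 :=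
        Finset.sum_le_sum fun i _ => ENNReal.tsum_le_tsum fun j => hij i j
    _ = (Fintype.card d * ∑' j : ℕ, ENNReal.ofReal ((Fintype.card d * ((2 : ℝ) ^ (j + 2)) ^ 2) ^ γ) *
          ENNReal.ofReal ((((2 : ℝ) ^ (j + 2))⁻¹) ^ (α : ℝ)) ^ 2) * (C : ℝ≥0∞) ^ 2 := by
        rw [Finset.sum_const, Finset.card_univ, nsmul_eq_mul, ENNReal.tsum_mul_right, mul_assoc]

end Torus

/-! ## De Rosa 2019, Cor. 7.2 -/

/-- **Discharge of `DeRosa2019_cor72`** (De Rosa 2019, Cor. 7.2): for `0 < γ < 1`, `0 < ε`,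
`γ + ε ≤ 1` there is `C = C(γ, ε) > 0` with
`∫_{𝕋³} |(-Δ)^{γ/2} f|² ≤ C [f]²_{γ+ε}` for all `f ∈ C^{γ+ε}(𝕋³; ℝ³)`. Proof: the embedding
`C^{γ+ε} ⊂ Ḣ^γ` (`Torus.exists_eHomSobolevSeminorm_sq_le_of_holderWith`) applied to the
complexified field (complexification is an isometry, so it has the same Hölder constant
`nnHolderNorm`), times the normalisation factor `(4π²)^γ` of `Torus.eFracDissipation`.
[cite: Derosa2018, §7 Cor. 7.2 (arXiv:1801.10235 p. 19)] -/
theorem DeRosa2019_cor72_holds : DeRosa2019_cor72 := by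
  intro γ ε hγ _hγ1 hε _hγε
  have hαr : ((Real.toNNReal (γ + ε) : ℝ≥0) : ℝ) = γ + ε := Real.coe_toNNReal _ (by linarith)
  have hγα : γ < ((Real.toNNReal (γ + ε) : ℝ≥0) : ℝ) := by rw [hαr]; linarith
  obtain ⟨S, hS, hbound⟩ :=
    Torus.exists_eHomSobolevSeminorm_sq_le_of_holderWith (d := Fin 3) (ι := Fin 3) hγ.le hγα
  refine ⟨(4 * Real.pi ^ 2) ^ γ * S.toReal + 1, by positivity, fun f hf => ?_⟩
  have hH := hf.holderWith
  have hg : HolderWith (nnHolderNorm (Real.toNNReal (γ + ε)) f) (Real.toNNReal (γ + ε))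
      (FunctionSpaces.EuclideanSpace.complexify ∘ f) := by
    intro x y
    rw [Function.comp_apply, Function.comp_apply,
      FunctionSpaces.EuclideanSpace.complexify.isometry.edist_eq]
    exact hH x y
  have h1 := hbound _ _ hg
  rw [← hf.coe_nnHolderNorm_eq_eHolderNorm]
  unfold Torus.eFracDissipation
  have hS' : ENNReal.ofReal ((4 * Real.pi ^ 2) ^ γ) * S =
      ENNReal.ofReal ((4 * Real.pi ^ 2) ^ γ * S.toReal) := by
    rw [ENNReal.ofReal_mul (by positivity), ENNReal.ofReal_toReal hS.ne]
  calc ENNReal.ofReal ((4 * Real.pi ^ 2) ^ γ) *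
        FunctionSpaces.Torus.eHomSobolevSeminorm γ (FunctionSpaces.EuclideanSpace.complexify ∘ f) ^ 2
      ≤ ENNReal.ofReal ((4 * Real.pi ^ 2) ^ γ) *
          (S * (nnHolderNorm (Real.toNNReal (γ + ε)) f : ℝ≥0∞) ^ 2) := mul_le_mul' le_rfl h1
    _ = ENNReal.ofReal ((4 * Real.pi ^ 2) ^ γ * S.toReal) *
          (nnHolderNorm (Real.toNNReal (γ + ε)) f : ℝ≥0∞) ^ 2 := by rw [← mul_assoc, hS']
    _ ≤ ENNReal.ofReal ((4 * Real.pi ^ 2) ^ γ * S.toReal + 1) *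
          (nnHolderNorm (Real.toNNReal (γ + ε)) f : ℝ≥0∞) ^ 2 :=
        mul_le_mul' (ENNReal.ofReal_le_ofReal (by linarith)) le_rfl

end Literature.Analysis.FluidPDE
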